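import Summits.AtomisticToContinuum.FouriersLaw.Theorems.EmbeddedDrudeMourreDrudeDissolutionStubGramContinuityKernelFamily
import HarnessLib

/-!
# Stub G `stub_gramContinuity`, tool 3: uniform ground-state Markov gap and continuous Jentzsch
eigenfunction for a continuous family of strictly positive kernels on a compact parameter set
(line `gram-pencil-harmonic-chaos`, crux `EmbeddedDrudeMourre.DrudeDissolution`,
item stmt-AtomisticToContinuum-12593; `--supports` file, closes nothing)

WHAT. The family version of `Literature.Analysis.OperatorTheory.exists_groundState_markov_gap`:
for kernels `K_ε` (`ε ∈ S`, `S ⊆ ℝ` compact) on ONE nonzero finite measure space, jointly measurable,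
symmetric, strictly positive, bounded by `C`, pointwise continuous in `ε`, there are `λ(ε) > 0`,
pointwise eigenfunctions `h_ε` (`∫ K_ε(x,y) h_ε(y) dμ = λ(ε) h_ε(x)`, `∫ h_ε² = 1`, `0 < h_ε ≤ B`)
and ONE `r < 1` such that the ground-state Markov operator of every `K_ε` contracts mean-zero
functions of `L²(h_ε² dμ)` by `rⁿ`; moreover `λ` is continuous on `S`, bounded below by `λ_min > 0`,
and `ε ↦ h_ε(x)` is continuous on `S` for every `x` (`kernel_family_uniform_markov_gap`, registered
sub-goal of stub G).

WHY. Applied (tool 4) to the symmetrised transfer kernels of the position marginals of the thermal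
states along the coupling ray `ε ↦ pinnedChain ω₂ (aε) (bε) 1` on `L²` of the Gaussian one-site
weight, this is exactly the `ε`-UNIFORM exponential `ρ`-mixing (via
`abs_integral_mul_sub_le_of_dependsOn_halfLine`) and the continuity in `ε` of the window densities
of the two-sided Markov chains `μ_ε` that stub G needs.

PROOF. `kernel_family_local_gap` (tool 2) + a finite subcover of `S`; the pointwise eigenfunction of
`exists_pointwise_eigenfunction` is identified with the Jentzsch eigenvector
(`toLp_eigenfunction_eq_norm`), the gap is transported to `L²(h² dμ)` as in
`exists_groundState_markov_gap`, and `h_ε(x) = λ(ε)⁻¹ ⟪K_ε(x, ·), φ_ε⟫` is continuous in `ε`.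
-/

noncomputable section

open MeasureTheory Set Filter Function Topology
open scoped RealInnerProductSpace ENNReal
open Literature.Analysis.OperatorTheory

namespace Summit.AtomisticToContinuum.FouriersLaw.Theorems.DrudeDissolution.GramPencilHarmonicChaos

section UniformGap

variable {X : Type} [MeasurableSpace X] {μ : Measure X} [IsFiniteMeasure μ]

omit [MeasurableSpace X] [IsFiniteMeasure μ] in
/-- A finite family of reals `< 1` is bounded by some `r ∈ [0, 1)`. [folklore] -/
theorem exists_lt_one_bound (t : Finset ℝ) (ρ : ℝ → ℝ) (h : ∀ i ∈ t, ρ i < 1) :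
    ∃ r : ℝ, 0 ≤ r ∧ r < 1 ∧ ∀ i ∈ t, ρ i ≤ r := by
  classical
  induction t using Finset.induction_on with
  | empty => exact ⟨0, le_rfl, one_pos, by simp⟩
  | insert a s ha ih =>
    obtain ⟨r, hr0, hr1, hr⟩ := ih fun i hi => h i (Finset.mem_insert_of_mem hi)
    refine ⟨max r (ρ a), le_max_of_le_left hr0, max_lt hr1 (h a (Finset.mem_insert_self a s)),
      fun i hi => ?_⟩
    rcases Finset.mem_insert.1 hi with rfl | hi
    · exact le_max_right _ _
    · exact (hr i hi).trans (le_max_left _ _)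

/-- **The ground-state Markov gap from a gap on the orthocomplement of the Jentzsch eigenvector**
(the transport step of `exists_groundState_markov_gap`, with the gap constant as a parameter).
[folklore] -/
theorem markov_gap_of_gap {K : X → X → ℝ} (hμ : μ ≠ 0) {A : Lp ℝ 2 μ →L[ℝ] Lp ℝ 2 μ}
    (hA : ∀ φ : Lp ℝ 2 μ, (A φ : X → ℝ) =ᵐ[μ] fun x => ∫ y, K x y * φ y ∂μ)
    (hsa : IsSelfAdjoint A) {φ₀ : Lp ℝ 2 μ} (hφ₀1 : ‖φ₀‖ = 1) (hφ₀pos : IsStrictlyPositiveFun φ₀)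
    (hAφ₀ : A φ₀ = ‖A‖ • φ₀) (hsimple : ∀ η : Lp ℝ 2 μ, A η = ‖A‖ • η → η = ⟪φ₀, η⟫ • φ₀)
    {θ : ℝ} (hθ0 : 0 ≤ θ) (hgapA : ∀ w : Lp ℝ 2 μ, ⟪φ₀, w⟫ = 0 → ‖A w‖ ≤ θ * ‖w‖)
    {lam : ℝ} {h : X → ℝ} (hlam : 0 < lam) (hhm : Measurable h) (hhpos : ∀ x, 0 < h x) {B : ℝ}
    (hhle : ∀ x, h x ≤ B) (heig : ∀ x, ∫ y, K x y * h y ∂μ = lam * h x)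
    (hnorm : ∫ x, h x ^ 2 ∂μ = 1) :
    lam = ‖A‖ ∧ (φ₀ : X → ℝ) =ᵐ[μ] h ∧
    ∀ u : X → ℝ, Measurable u → (∃ M : ℝ, ∀ x, |u x| ≤ M) → ∫ x, u x * h x ^ 2 ∂μ = 0 →
      ∀ n : ℕ, ∫ x, ((fun (v : X → ℝ) (x : X) => ∫ y, (lam * h x)⁻¹ * K x y * h y * v y ∂μ)^[n] u) x
        ^ 2 * h x ^ 2 ∂μ ≤ (θ / lam) ^ (2 * n) * ∫ x, u x ^ 2 * h x ^ 2 ∂μ := by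
  have hhb : ∀ x, ‖h x‖ ≤ B := fun x => by
    rw [Real.norm_eq_abs, abs_of_pos (hhpos x)]; exact hhle x
  obtain ⟨hAh, hlamA, hip, hprop⟩ :=
    toLp_eigenfunction_eq_norm hμ hA hsa hφ₀pos hAφ₀ hsimple hhm hhpos hhb heig
  set hL : Lp ℝ 2 μ := (memLp_two_of_bound (μ := μ) hhm hhb).toLp h with hhL
  have hcoe : (hL : X → ℝ) =ᵐ[μ] h := MemLp.coeFn_toLp _
  have hnormh : ‖hL‖ = 1 := by
    have h1 : ‖hL‖ ^ 2 = 1 := by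
      rw [← real_inner_self_eq_norm_sq, inner_eq_integral, ← hnorm]
      refine integral_congr_ae ?_
      filter_upwards [hcoe] with x hx
      rw [hx, sq]
    have h2 := norm_nonneg hL
    nlinarith
  -- `[h] = φ₀`
  have hc1 : ⟪φ₀, hL⟫ = 1 := by
    have h1 : ‖hL‖ = |⟪φ₀, hL⟫| * ‖φ₀‖ := by
      conv_lhs => rw [hprop]
      rw [norm_smul, Real.norm_eq_abs]
    rw [hnormh, hφ₀1, mul_one] at h1
    have := abs_of_pos hip
    linarith
  have hLeq : hL = φ₀ := by rw [hprop, hc1, one_smul]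
  refine ⟨hlamA, by rw [← hLeq]; exact hcoe, fun u hum hub hmean n => ?_⟩
  have hgap_h : ∀ w : Lp ℝ 2 μ, ⟪hL, w⟫ = 0 → ‖A w‖ ≤ θ * ‖w‖ := fun w hw =>
    hgapA w (by rwa [hLeq] at hw)
  obtain ⟨M, huM⟩ := hub
  have hvm : Measurable fun x => h x * u x := hhm.mul hum
  have hvb : ∀ x, ‖h x * u x‖ ≤ B * M := fun x => by
    rw [norm_mul, Real.norm_eq_abs (u x)]
    exact mul_le_mul (hhb x) (huM x) (abs_nonneg _) ((norm_nonneg _).trans (hhb x))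
  set vL : Lp ℝ 2 μ := (memLp_two_of_bound (μ := μ) hvm hvb).toLp (fun x => h x * u x) with hvL
  have hvcoe : (vL : X → ℝ) =ᵐ[μ] fun x => h x * u x := MemLp.coeFn_toLp _
  set W : X → ℝ := (fun (v : X → ℝ) (x : X) => ∫ y, (lam * h x)⁻¹ * K x y * h y * v y ∂μ)^[n] u
    with hW
  have hAe : ((A ^ n) vL : X → ℝ) =ᵐ[μ] fun x => lam ^ n * (h x * W x) := by
    have h1 := pow_kernelOp_toLp_ae_eq_iterate hA hvm hvb n
    rw [kernelIterate_mul_eigenfunction (K := K) (μ := μ) hlam hhpos u n] at h1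
    exact h1
  have hin : ⟪hL, vL⟫ = 0 := by
    rw [inner_eq_integral, ← hmean]
    refine integral_congr_ae ?_
    filter_upwards [hcoe, hvcoe] with x hx hv
    rw [hx, hv]
    ring
  have hN1 : ‖(A ^ n) vL‖ ^ 2 = lam ^ (2 * n) * ∫ x, W x ^ 2 * h x ^ 2 ∂μ := by
    rw [← real_inner_self_eq_norm_sq, inner_eq_integral, ← integral_const_mul]
    refine integral_congr_ae ?_
    filter_upwards [hAe] with x hx
    rw [hx]
    ring
  have hN2 : ‖vL‖ ^ 2 = ∫ x, u x ^ 2 * h x ^ 2 ∂μ := by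
    rw [← real_inner_self_eq_norm_sq, inner_eq_integral]
    refine integral_congr_ae ?_
    filter_upwards [hvcoe] with x hv
    rw [hv]
    ring
  have hb := norm_pow_apply_sub_le_of_gap hsa hnormh hAh hθ0 hgap_h n vL
  rw [hin, mul_zero, zero_smul, sub_zero] at hb
  have hsq : ‖(A ^ n) vL‖ ^ 2 ≤ (θ ^ n * ‖vL‖) ^ 2 := pow_le_pow_left₀ (norm_nonneg _) hb 2
  rw [hN1, mul_pow, ← pow_mul, hN2, mul_comm n 2] at hsq
  rw [div_pow, div_mul_eq_mul_div, le_div_iff₀ (pow_pos hlam _), mul_comm]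
  exact hsq

/-- **Uniform ground-state Markov gap and continuous Jentzsch eigenfunction for a continuous
family of strictly positive kernels on a compact parameter set** (named-hypotheses form of the
registered `kernel_family_uniform_markov_gap`). [folklore] -/
theorem kernel_family_uniform_markov_gap' (hμ : μ ≠ 0) {S : Set ℝ} (hS : IsCompact S)
    {K : ℝ → X → X → ℝ} {C : ℝ}
    (hKm : ∀ ε ∈ S, StronglyMeasurable (uncurry (K ε)))
    (hKC : ∀ ε ∈ S, ∀ x y, ‖K ε x y‖ ≤ C) (hKs : ∀ ε ∈ S, ∀ x y, K ε x y = K ε y x)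
    (hKp : ∀ ε ∈ S, ∀ x y, 0 < K ε x y) (hKc : ∀ x y, ContinuousOn (fun ε => K ε x y) S) :
    ∃ (lam : ℝ → ℝ) (h : ℝ → X → ℝ) (B r lmin : ℝ), 0 ≤ r ∧ r < 1 ∧ 0 < lmin ∧
      ContinuousOn lam S ∧ (∀ x, ContinuousOn (fun ε => h ε x) S) ∧
      ∀ ε ∈ S, lmin ≤ lam ε ∧ Measurable (h ε) ∧ (∀ x, 0 < h ε x) ∧ (∀ x, h ε x ≤ B) ∧
        (∀ x, Integrable (fun y => K ε x y * h ε y) μ) ∧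
        (∀ x, ∫ y, K ε x y * h ε y ∂μ = lam ε * h ε x) ∧
        Integrable (fun x => h ε x ^ 2) μ ∧ ∫ x, h ε x ^ 2 ∂μ = 1 ∧
        ∀ u : X → ℝ, Measurable u → (∃ M : ℝ, ∀ x, |u x| ≤ M) → ∫ x, u x * h ε x ^ 2 ∂μ = 0 →
          ∀ n : ℕ, ∫ x, ((fun (v : X → ℝ) (x : X) =>
            ∫ y, (lam ε * h ε x)⁻¹ * K ε x y * h ε y * v y ∂μ)^[n] u) x ^ 2 * h ε x ^ 2 ∂μ ≤
            r ^ (2 * n) * ∫ x, u x ^ 2 * h ε x ^ 2 ∂μ := by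
  classical
  obtain ⟨A, φ₀, hspec, hd, hφc, hloc⟩ := kernel_family_local_gap' hμ hKm hKC hKs hKp hKc
  -- Step 1: one `r < 1` for all `ε ∈ S` (finite subcover)
  choose! ρ hρ1 hρev using hloc
  set U : ℝ → Set ℝ := fun ε₀ => {ε | ε ∈ S → ∀ w : Lp ℝ 2 μ, ⟪φ₀ ε, w⟫ = 0 →
    ‖A ε w‖ ≤ ρ ε₀ * ‖A ε‖ * ‖w‖} with hU
  have hUn : ∀ ε₀ ∈ S, U ε₀ ∈ 𝓝 ε₀ := fun ε₀ hε₀ =>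
    eventually_nhdsWithin_iff.1 (hρev ε₀ hε₀)
  obtain ⟨t, htS, hcov⟩ := hS.elim_nhds_subcover U hUn
  obtain ⟨r, hr0, hr1, hr⟩ := exists_lt_one_bound t ρ fun i hi => hρ1 i (htS i hi)
  have hgap : ∀ ε ∈ S, ∀ w : Lp ℝ 2 μ, ⟪φ₀ ε, w⟫ = 0 → ‖A ε w‖ ≤ r * ‖A ε‖ * ‖w‖ := by
    intro ε hε w hw
    obtain ⟨i, hi, hεi⟩ := mem_iUnion₂.1 (hcov hε)
    calc ‖A ε w‖ ≤ ρ i * ‖A ε‖ * ‖w‖ := hεi hε w hw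
      _ ≤ r * ‖A ε‖ * ‖w‖ := by
          have := hr i hi
          have : 0 ≤ ‖A ε‖ * ‖w‖ := by positivity
          nlinarith
  -- Step 2: pointwise eigenfunctions
  have hex : ∀ ε, ∃ (lam : ℝ) (h : X → ℝ), ε ∈ S → 0 < lam ∧ Measurable h ∧ (∀ x, 0 < h x) ∧
      (∃ B : ℝ, ∀ x, h x ≤ B) ∧ (∀ x, Integrable (fun y => K ε x y * h y) μ) ∧
      (∀ x, ∫ y, K ε x y * h y ∂μ = lam * h x) ∧ Integrable (fun x => h x ^ 2) μ ∧
      ∫ x, h x ^ 2 ∂μ = 1 := by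
    intro ε
    by_cases hε : ε ∈ S
    · obtain ⟨lam, h, B, h1, h2, h3, h4, h5, h6, h7, h8⟩ :=
        exists_pointwise_eigenfunction (μ := μ) (hKm ε hε) (hKC ε hε) (hKs ε hε) (hKp ε hε) hμ
      exact ⟨lam, h, fun _ => ⟨h1, h2, h3, ⟨B, h4⟩, h5, h6, h7, h8⟩⟩
    · exact ⟨0, 0, fun h => absurd h hε⟩
  choose lam h hh using hex
  -- Step 3: identification with the Jentzsch data and the Markov gap
  have hmain : ∀ ε ∈ S, lam ε = ‖A ε‖ ∧ (φ₀ ε : X → ℝ) =ᵐ[μ] h ε ∧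
      ∀ u : X → ℝ, Measurable u → (∃ M : ℝ, ∀ x, |u x| ≤ M) → ∫ x, u x * h ε x ^ 2 ∂μ = 0 →
        ∀ n : ℕ, ∫ x, ((fun (v : X → ℝ) (x : X) =>
          ∫ y, (lam ε * h ε x)⁻¹ * K ε x y * h ε y * v y ∂μ)^[n] u) x ^ 2 * h ε x ^ 2 ∂μ ≤
          (r * ‖A ε‖ / lam ε) ^ (2 * n) * ∫ x, u x ^ 2 * h ε x ^ 2 ∂μ := by
    intro ε hε
    obtain ⟨hlam, hhm, hhpos, ⟨B, hhle⟩, -, heig, -, hnorm⟩ := hh ε hε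
    obtain ⟨hA, hsa, h0, hn1, hp, he, hsimple⟩ := hspec ε hε
    have hθ0 : 0 ≤ r * ‖A ε‖ := by positivity
    exact markov_gap_of_gap hμ hA hsa hn1 hp he hsimple hθ0
      (hgap ε hε) hlam hhm hhpos hhle heig hnorm
  -- Step 4: continuity of `lam` and the lower bound
  have hlamc : ContinuousOn lam S := by
    have h1 : ContinuousOn (fun ε => ‖A ε‖) S := by
      intro ε₀ hε₀
      rw [ContinuousWithinAt, tendsto_iff_norm_sub_tendsto_zero]
      refine squeeze_zero' (Eventually.of_forall fun ε => norm_nonneg _)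
        (Eventually.of_forall fun ε => ?_) (hd ε₀ hε₀)
      rw [Real.norm_eq_abs]
      exact abs_norm_sub_norm_le _ _
    exact h1.congr fun ε hε => (hmain ε hε).1
  obtain ⟨lmin, hlmin, hlminle⟩ : ∃ lmin : ℝ, 0 < lmin ∧ ∀ ε ∈ S, lmin ≤ lam ε := by
    rcases S.eq_empty_or_nonempty with hS0 | hSne
    · exact ⟨1, one_pos, fun ε hε => by simp [hS0] at hε⟩
    · obtain ⟨ε₁, hε₁, hmin⟩ := hS.exists_isMinOn hSne hlamc
      exact ⟨lam ε₁, (hh ε₁ hε₁).1, fun ε hε => hmin hε⟩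
  -- Step 5: the uniform bound on `h`
  have hC0 : ∀ ε ∈ S, 0 ≤ C := fun ε hε => by
    have : μ univ ≠ 0 := fun h0 => hμ (Measure.measure_univ_eq_zero.1 h0)
    obtain ⟨x, -⟩ := nonempty_of_measure_ne_zero this
    exact (norm_nonneg _).trans (hKC ε hε x x)
  set B : ℝ := lmin⁻¹ * (|C| * Real.sqrt (μ.real univ)) with hB
  have hhB : ∀ ε ∈ S, ∀ x, h ε x ≤ B := by
    intro ε hε x
    obtain ⟨hlam, -, -, -, -, heig, -, -⟩ := hh ε hε
    obtain ⟨-, -, -, hn1, -, -, -⟩ := hspec ε hε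
    have hae := (hmain ε hε).2.1
    have h1 : ∫ y, K ε x y * h ε y ∂μ = ∫ y, K ε x y * φ₀ ε y ∂μ :=
      integral_congr_ae (by filter_upwards [hae] with y hy; rw [hy])
    have h2 : |∫ y, K ε x y * φ₀ ε y ∂μ| ≤ |C| * Real.sqrt (μ.real univ) * ‖φ₀ ε‖ :=
      abs_integral_kernel_mul_le (fun x y => (hKC ε hε x y).trans (le_abs_self C)) (abs_nonneg C)
        (φ₀ ε) x
    rw [hn1, mul_one] at h2
    have h3 : h ε x = (lam ε)⁻¹ * ∫ y, K ε x y * h ε y ∂μ := by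
      rw [heig, ← mul_assoc, inv_mul_cancel₀ hlam.ne', one_mul]
    rw [h3, h1, hB]
    have h4 : (lam ε)⁻¹ ≤ lmin⁻¹ := (inv_le_inv₀ hlam hlmin).2 (hlminle ε hε)
    have h5 : 0 ≤ |C| * Real.sqrt (μ.real univ) := by positivity
    calc (lam ε)⁻¹ * ∫ y, K ε x y * φ₀ ε y ∂μ ≤ (lam ε)⁻¹ * (|C| * Real.sqrt (μ.real univ)) :=
          mul_le_mul_of_nonneg_left ((le_abs_self _).trans h2) (inv_pos.2 hlam).le
      _ ≤ lmin⁻¹ * (|C| * Real.sqrt (μ.real univ)) := mul_le_mul_of_nonneg_right h4 h5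
  -- Step 6: continuity of `ε ↦ h ε x`
  have hhc : ∀ x, ContinuousOn (fun ε => h ε x) S := by
    intro x ε₀ hε₀
    -- `h ε x = (lam ε)⁻¹ * ∫ K ε x y * φ₀ ε y`
    have hrepr : ∀ ε ∈ S, h ε x = (lam ε)⁻¹ * ∫ y, K ε x y * φ₀ ε y ∂μ := by
      intro ε hε
      obtain ⟨hlam, -, -, -, -, heig, -, -⟩ := hh ε hε
      have hae := (hmain ε hε).2.1
      rw [← integral_congr_ae (by filter_upwards [hae] with y hy; rw [hy]) , heig, ← mul_assoc,
        inv_mul_cancel₀ hlam.ne', one_mul]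
    -- the integral is continuous in `ε` within `S`
    have hint : Tendsto (fun ε => ∫ y, K ε x y * φ₀ ε y ∂μ) (𝓝[S] ε₀)
        (𝓝 (∫ y, K ε₀ x y * φ₀ ε₀ y ∂μ)) := by
      rw [tendsto_iff_norm_sub_tendsto_zero]
      -- the two error terms
      have hsec : ∀ ε ∈ S, MemLp (fun y => K ε x y - K ε₀ x y) 2 μ := fun ε hε =>
        (memLp_kernel_section (μ := μ) (hKm ε hε) (hKC ε hε) x).sub
          (memLp_kernel_section (μ := μ) (hKm ε₀ hε₀) (hKC ε₀ hε₀) x)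
      have hT1 : Tendsto (fun ε => ∫ y, (K ε x y - K ε₀ x y) ^ 2 ∂μ) (𝓝[S] ε₀) (𝓝 0) := by
        have hlim : Tendsto (fun ε => ∫ y, (K ε x y - K ε₀ x y) ^ 2 ∂μ) (𝓝[S] ε₀)
            (𝓝 (∫ _y : X, (0 : ℝ) ∂μ)) := by
          refine tendsto_integral_filter_of_dominated_convergence (fun _ => (C + C) ^ 2) ?_ ?_
            (integrable_const _) (ae_of_all _ fun y => ?_)
          · filter_upwards [self_mem_nhdsWithin] with ε hε
            exact (continuous_pow 2).comp_aestronglyMeasurable (hsec ε hε).1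
          · filter_upwards [self_mem_nhdsWithin] with ε hε
            refine ae_of_all _ fun y => ?_
            have h1 := hKC ε hε x y
            have h2 := hKC ε₀ hε₀ x y
            rw [Real.norm_eq_abs] at h1 h2
            have h3 : |K ε x y - K ε₀ x y| ≤ C + C := (abs_sub _ _).trans (add_le_add h1 h2)
            rw [Real.norm_eq_abs, abs_pow]
            exact pow_le_pow_left₀ (abs_nonneg _) h3 2
          · have h1 := ((hKc x y).continuousWithinAt hε₀).tendsto
            have h2 : Tendsto (fun ε => (K ε x y - K ε₀ x y) ^ 2) (𝓝[S] ε₀)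
                (𝓝 ((K ε₀ x y - K ε₀ x y) ^ 2)) := (h1.sub tendsto_const_nhds).pow 2
            rwa [sub_self, zero_pow two_ne_zero] at h2
        rwa [integral_zero] at hlim
      have hC0' := hC0 ε₀ hε₀
      have hbound : ∀ ε ∈ S, ‖(∫ y, K ε x y * φ₀ ε y ∂μ) - ∫ y, K ε₀ x y * φ₀ ε₀ y ∂μ‖ ≤
          Real.sqrt (∫ y, (K ε x y - K ε₀ x y) ^ 2 ∂μ) +
            C * Real.sqrt (μ.real univ) * ‖φ₀ ε - φ₀ ε₀‖ := by
        intro ε hε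
        obtain ⟨-, -, -, hn1, -, -, -⟩ := hspec ε hε
        have i1 := integrable_kernel_mul_coeFn (μ := μ) (hKm ε hε) (hKC ε hε) (φ₀ ε) x
        have i2 := integrable_kernel_mul_coeFn (μ := μ) (hKm ε₀ hε₀) (hKC ε₀ hε₀) (φ₀ ε) x
        have i3 := integrable_kernel_mul_coeFn (μ := μ) (hKm ε₀ hε₀) (hKC ε₀ hε₀) (φ₀ ε₀) x
        have i4 := integrable_kernel_mul_coeFn (μ := μ) (hKm ε₀ hε₀) (hKC ε₀ hε₀) (φ₀ ε - φ₀ ε₀) x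
        -- split
        have e1 : (∫ y, K ε x y * φ₀ ε y ∂μ) - ∫ y, K ε₀ x y * φ₀ ε₀ y ∂μ =
            (∫ y, (K ε x y - K ε₀ x y) * φ₀ ε y ∂μ) + ∫ y, K ε₀ x y * (φ₀ ε - φ₀ ε₀) y ∂μ := by
          have e2 : ∫ y, K ε₀ x y * (φ₀ ε - φ₀ ε₀) y ∂μ =
              ∫ y, (K ε₀ x y * φ₀ ε y - K ε₀ x y * φ₀ ε₀ y) ∂μ := by
            refine integral_congr_ae ?_
            filter_upwards [Lp.coeFn_sub (φ₀ ε) (φ₀ ε₀)] with y hy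
            rw [hy, Pi.sub_apply, mul_sub]
          have e3 : ∫ y, (K ε x y - K ε₀ x y) * φ₀ ε y ∂μ =
              (∫ y, K ε x y * φ₀ ε y ∂μ) - ∫ y, K ε₀ x y * φ₀ ε y ∂μ := by
            rw [← integral_sub i1 i2]
            exact integral_congr_ae (ae_of_all _ fun y => by ring)
          rw [e2, integral_sub i2 i3, e3]; ring
        rw [e1]
        refine (norm_add_le _ _).trans (add_le_add ?_ ?_)
        · have hcs := sq_integral_l2Kernel_mul_le (μ := μ) (K := fun x' y => K ε x' y - K ε₀ x' y)
            (x := x) (hsec ε hε) (φ₀ ε)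
          rw [hn1, one_pow, mul_one] at hcs
          rw [Real.norm_eq_abs]
          exact Real.abs_le_sqrt hcs
        · rw [Real.norm_eq_abs]
          exact abs_integral_kernel_mul_le (hKC ε₀ hε₀) hC0' (φ₀ ε - φ₀ ε₀) x
      have hT : Tendsto (fun ε => Real.sqrt (∫ y, (K ε x y - K ε₀ x y) ^ 2 ∂μ) +
          C * Real.sqrt (μ.real univ) * ‖φ₀ ε - φ₀ ε₀‖) (𝓝[S] ε₀) (𝓝 0) := by
        have h1 := hT1.sqrt
        have h2 := (hφc ε₀ hε₀).const_mul (C * Real.sqrt (μ.real univ))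
        rw [Real.sqrt_zero] at h1
        rw [mul_zero] at h2
        simpa using h1.add h2
      refine squeeze_zero' (Eventually.of_forall fun ε => norm_nonneg _) ?_ hT
      filter_upwards [self_mem_nhdsWithin] with ε hε
      exact hbound ε hε
    have hlam0 : lam ε₀ ≠ 0 := (hh ε₀ hε₀).1.ne'
    have hT := ((hlamc ε₀ hε₀).tendsto.inv₀ hlam0).mul hint
    rw [ContinuousWithinAt, hrepr ε₀ hε₀]
    exact hT.congr' (by filter_upwards [self_mem_nhdsWithin] with ε hε; exact (hrepr ε hε).symm)
  -- assembly
  refine ⟨lam, h, B, r, lmin, hr0, hr1, hlmin, hlamc, hhc, fun ε hε => ?_⟩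
  obtain ⟨hlam, hhm, hhpos, -, hint, heig, hsq, hnorm⟩ := hh ε hε
  obtain ⟨hlamA, -, hgapM⟩ := hmain ε hε
  refine ⟨hlminle ε hε, hhm, hhpos, hhB ε hε, hint, heig, hsq, hnorm, fun u hum hub hmean n => ?_⟩
  have h1 := hgapM u hum hub hmean n
  have h2 : r * ‖A ε‖ / lam ε = r := by rw [← hlamA, mul_div_assoc, div_self hlam.ne', mul_one]
  rwa [h2] at h1

/-- **Uniform ground-state Markov gap and continuous Jentzsch eigenfunction for a continuous family
of strictly positive kernels on a compact parameter set** (registered sub-goal of stub G; see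
`kernel_family_uniform_markov_gap'`). [folklore] -/
theorem kernel_family_uniform_markov_gap : ∀ {X : Type} [MeasurableSpace X]
    (μ : MeasureTheory.Measure X) [MeasureTheory.IsFiniteMeasure μ], μ ≠ 0 → ∀ (S : Set ℝ),
    IsCompact S → ∀ (K : ℝ → X → X → ℝ) (C : ℝ),
    (∀ ε ∈ S, MeasureTheory.StronglyMeasurable (Function.uncurry (K ε))) →
    (∀ ε ∈ S, ∀ x y, ‖K ε x y‖ ≤ C) → (∀ ε ∈ S, ∀ x y, K ε x y = K ε y x) →
    (∀ ε ∈ S, ∀ x y, 0 < K ε x y) → (∀ x y, ContinuousOn (fun ε => K ε x y) S) →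
    ∃ (lam : ℝ → ℝ) (h : ℝ → X → ℝ) (B r lmin : ℝ), 0 ≤ r ∧ r < 1 ∧ 0 < lmin ∧
      ContinuousOn lam S ∧ (∀ x, ContinuousOn (fun ε => h ε x) S) ∧
      ∀ ε ∈ S, lmin ≤ lam ε ∧ Measurable (h ε) ∧ (∀ x, 0 < h ε x) ∧ (∀ x, h ε x ≤ B) ∧
        (∀ x, MeasureTheory.Integrable (fun y => K ε x y * h ε y) μ) ∧
        (∀ x, ∫ y, K ε x y * h ε y ∂μ = lam ε * h ε x) ∧
        MeasureTheory.Integrable (fun x => h ε x ^ 2) μ ∧ ∫ x, h ε x ^ 2 ∂μ = 1 ∧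
        ∀ u : X → ℝ, Measurable u → (∃ M : ℝ, ∀ x, |u x| ≤ M) → ∫ x, u x * h ε x ^ 2 ∂μ = 0 →
          ∀ n : ℕ, ∫ x, ((fun (v : X → ℝ) (x : X) =>
            ∫ y, (lam ε * h ε x)⁻¹ * K ε x y * h ε y * v y ∂μ)^[n] u) x ^ 2 * h ε x ^ 2 ∂μ ≤
            r ^ (2 * n) * ∫ x, u x ^ 2 * h ε x ^ 2 ∂μ :=
  fun _ _ hμ _ hS _ _ hKm hKC hKs hKp hKc => kernel_family_uniform_markov_gap' hμ hS hKm hKC hKs hKp hKc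

end UniformGap

end Summit.AtomisticToContinuum.FouriersLaw.Theorems.DrudeDissolution.GramPencilHarmonicChaos

end
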